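import Summits.CriticalPhenomena.SAWScalingLimit.Theorems.SAWDefectDecoherenceBoundaryClosureRZigzagDiscretisationCharts
import HarnessLib

/-!
# Crux `BoundaryClosureR` (stmt-CriticalPhenomena-14004), line `polygon-parity-squeeze`,
# stub `stub_innerPolygonsOfZigzag` (7b): local charts of a zigzag polygon — frontiers

Landing target:
`Summits/CriticalPhenomena/SAWScalingLimit/Theorems/SAWDefectDecoherenceBoundaryClosureRZigzagDiscretisationFrontier.lean`
(`--supports stmt-CriticalPhenomena-14004`; building block of the registered stub
`stub_innerPolygonsOfZigzag`, the lattice half of the inner-polygon construction (IP)).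

The frontier of a set described by local charts (companion of `…ZigzagDiscretisationCharts`):

* `frontier_inter_eq_of_inter_eq` — **the frontier is local**: sets agreeing on an open set have the
  same frontier there; `frontier_halfPlane`, `closure_halfPlane_subset`, `closure_compl_halfPlane`;
* `frontier_of_flat_chart` — in a flat chart `S ∩ B = halfPlane k z ∩ B` the frontier of `S` inside `B`
  is the line; `frontier_of_inter_chart` / `frontier_of_union_chart` — in a corner chart it lies on
  the two rays (with the sign of the other level: `≥ 0` at a convex corner, `≤ 0` at a reflex one);
* conversely `mem_frontier_of_line`, `mem_frontier_of_ray_inter`, `mem_frontier_of_ray_union` — line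
  and ray points ARE frontier points.

Sources: folklore plane topology.  No proposition is defined and no named fact is introduced.
-/

noncomputable section

open scoped ComplexConjugate Topology
open Set Metric Filter
open Literature.Probability.LatticeModels
open Summit.CriticalPhenomena.SAWScalingLimit.Theorems.PolygonParitySqueeze.InnerZigzag
  (level_split level_add_smul halfPlane_eq_of_level_eq_zero)

namespace Summit.CriticalPhenomena.SAWScalingLimit.Theorems.PolygonParitySqueeze.ZigzagDiscretisation

/-! ### Frontiers of charts -/

/-- **The frontier is local**: two sets that agree on an open set have the same frontier there.
[folklore] -/
theorem frontier_inter_eq_of_inter_eq {S Q U : Set ℂ} (hU : IsOpen U) (h : S ∩ U = Q ∩ U) :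
    frontier S ∩ U = frontier Q ∩ U := by
  suffices key : ∀ S Q : Set ℂ, S ∩ U = Q ∩ U → frontier S ∩ U ⊆ frontier Q ∩ U from
    (key S Q h).antisymm (key Q S h.symm)
  intro S Q h x ⟨hx, hxU⟩
  refine ⟨?_, hxU⟩
  rw [frontier, Set.mem_sdiff] at hx ⊢
  refine ⟨?_, ?_⟩
  · have h1 : x ∈ closure (U ∩ S) := hU.inter_closure ⟨hxU, hx.1⟩
    rw [inter_comm, h] at h1
    exact closure_mono inter_subset_left h1
  · intro hint
    have h1 : x ∈ interior (Q ∩ U) := by rw [interior_inter, hU.interior_eq]; exact ⟨hint, hxU⟩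
    rw [← h, interior_inter] at h1
    exact hx.2 h1.1

/-- The closure of an open half-plane lies in the closed half-plane. [folklore] -/
theorem closure_halfPlane_subset (k : Fin 6) (z : ℂ) :
    closure (halfPlane k z) ⊆ {w : ℂ | 0 ≤ ((w - z) * conj (innerNormal k)).re} :=
  closure_lt_subset_le continuous_const (continuous_level k z)

/-- The closure of the complement of an open half-plane is the complementary closed half-plane.
[folklore] -/
theorem closure_compl_halfPlane (k : Fin 6) (z : ℂ) :
    closure (halfPlane k z)ᶜ = {w : ℂ | ((w - z) * conj (innerNormal k)).re ≤ 0} := by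
  rw [(isOpen_halfPlane k z).isClosed_compl.closure_eq]
  ext w
  simp only [mem_compl_iff, mem_halfPlane_iff_level, not_lt, mem_setOf_eq]

/-- A point outside a set which is approached by points of the set is on its frontier. [folklore] -/
theorem mem_frontier_of_approach {S : Set ℂ} {w : ℂ} (hw : w ∉ S)
    (h : ∀ ε > 0, ∃ y ∈ S, dist w y < ε) : w ∈ frontier S := by
  rw [frontier_eq_closure_inter_closure]
  exact ⟨Metric.mem_closure_iff.2 h, subset_closure hw⟩

/-- **The frontier of a half-plane is its line.** [folklore] -/
theorem frontier_halfPlane (k : Fin 6) (z : ℂ) :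
    frontier (halfPlane k z) = {w : ℂ | ((w - z) * conj (innerNormal k)).re = 0} := by
  apply Subset.antisymm
  · intro w hw
    have := frontier_lt_subset_eq continuous_const (continuous_level k z) hw
    exact (Eq.symm this)
  · intro w hw
    refine mem_frontier_of_approach (by rw [mem_halfPlane_iff_level, hw]; exact lt_irrefl 0) fun ε hε => ?_
    refine ⟨w + ((ε / 2 : ℝ) : ℂ) * innerNormal k, ?_, ?_⟩
    · rw [mem_halfPlane_iff_level, level_add_real_mul_innerNormal_self, hw]; linarith
    · rw [dist_eq_norm, sub_add_cancel_left, norm_neg, norm_mul, norm_innerNormal, Complex.norm_real,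
        Real.norm_of_nonneg (by positivity)]
      linarith

/-- **The frontier in a flat chart is the line.** [folklore] -/
theorem frontier_of_flat_chart {S : Set ℂ} {k : Fin 6} {z : ℂ} {R : ℝ}
    (h : S ∩ ball z R = halfPlane k z ∩ ball z R) :
    frontier S ∩ ball z R = {w : ℂ | ((w - z) * conj (innerNormal k)).re = 0} ∩ ball z R := by
  rw [frontier_inter_eq_of_inter_eq isOpen_ball h, frontier_halfPlane]

/-- **Frontier points of a convex corner chart lie on the two rays** (sign `+` of the other level).
[folklore] -/
theorem frontier_of_inter_chart {S : Set ℂ} {k k' : Fin 6} {c : ℂ} {R : ℝ}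
    (h : S ∩ ball c R = halfPlane k c ∩ halfPlane k' c ∩ ball c R) {w : ℂ} (hw : w ∈ frontier S)
    (hwR : w ∈ ball c R) :
    (((w - c) * conj (innerNormal k)).re = 0 ∧ 0 ≤ ((w - c) * conj (innerNormal k')).re) ∨
    (((w - c) * conj (innerNormal k')).re = 0 ∧ 0 ≤ ((w - c) * conj (innerNormal k)).re) := by
  have h1 : w ∈ frontier (halfPlane k c ∩ halfPlane k' c) ∩ ball c R := by
    rw [← frontier_inter_eq_of_inter_eq isOpen_ball h]; exact ⟨hw, hwR⟩
  rcases frontier_inter_subset _ _ h1.1 with ⟨ha, hb⟩ | ⟨ha, hb⟩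
  · rw [frontier_halfPlane] at ha
    exact Or.inl ⟨ha, closure_halfPlane_subset k' c hb⟩
  · rw [frontier_halfPlane] at hb
    exact Or.inr ⟨hb, closure_halfPlane_subset k c ha⟩

/-- **Frontier points of a reflex corner chart lie on the two rays** (sign `-` of the other level).
[folklore] -/
theorem frontier_of_union_chart {S : Set ℂ} {k k' : Fin 6} {c : ℂ} {R : ℝ}
    (h : S ∩ ball c R = (halfPlane k c ∪ halfPlane k' c) ∩ ball c R) {w : ℂ} (hw : w ∈ frontier S)
    (hwR : w ∈ ball c R) :
    (((w - c) * conj (innerNormal k)).re = 0 ∧ ((w - c) * conj (innerNormal k')).re ≤ 0) ∨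
    (((w - c) * conj (innerNormal k')).re = 0 ∧ ((w - c) * conj (innerNormal k)).re ≤ 0) := by
  have h1 : w ∈ frontier (halfPlane k c ∪ halfPlane k' c) ∩ ball c R := by
    rw [← frontier_inter_eq_of_inter_eq isOpen_ball h]; exact ⟨hw, hwR⟩
  rcases frontier_union_subset _ _ h1.1 with ⟨ha, hb⟩ | ⟨ha, hb⟩
  · rw [frontier_halfPlane] at ha
    rw [closure_compl_halfPlane] at hb
    exact Or.inl ⟨ha, hb⟩
  · rw [frontier_halfPlane] at hb
    rw [closure_compl_halfPlane] at ha
    exact Or.inr ⟨hb, ha⟩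

/-- In a chart `S ∩ B = Q ∩ B`, a point of `B` outside `Q` approached by points of `Q ∩ B` is a
frontier point of `S`. [folklore] -/
theorem mem_frontier_of_chart {S Q B : Set ℂ} (h : S ∩ B = Q ∩ B) {w : ℂ} (hwB : w ∈ B) (hwQ : w ∉ Q)
    (happ : ∀ ε > 0, ∃ y ∈ Q ∩ B, dist w y < ε) : w ∈ frontier S := by
  refine mem_frontier_of_approach (fun hwS => hwQ ?_) fun ε hε => ?_
  · have : w ∈ Q ∩ B := h ▸ ⟨hwS, hwB⟩
    exact this.1
  · obtain ⟨y, hy, hd⟩ := happ ε hε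
    rw [← h] at hy
    exact ⟨y, hy.1, hd⟩

/-- The point `w + t·n_k` for small `t > 0`: level `t` more against `n_k`, at least `-t` change
against any `n_j`, within `t` of `w`. [folklore] -/
theorem step_estimates (k j : Fin 6) (z w : ℂ) {t : ℝ} (ht : 0 < t) :
    ((w + (t : ℂ) * innerNormal k - z) * conj (innerNormal k)).re = ((w - z) * conj (innerNormal k)).re + t ∧
    ((w - z) * conj (innerNormal j)).re - t ≤ ((w + (t : ℂ) * innerNormal k - z) * conj (innerNormal j)).re ∧
    dist w (w + (t : ℂ) * innerNormal k) = t := by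
  refine ⟨level_add_real_mul_innerNormal_self k z w t, ?_, ?_⟩
  · rw [level_add_real_mul_innerNormal]
    have h1 : -1 ≤ (innerNormal k * conj (innerNormal j)).re := by
      have := Complex.abs_re_le_norm (innerNormal k * conj (innerNormal j))
      rw [norm_mul, Complex.norm_conj, norm_innerNormal, norm_innerNormal, mul_one] at this
      have := neg_abs_le (innerNormal k * conj (innerNormal j)).re
      linarith
    nlinarith
  · rw [dist_eq_norm, sub_add_cancel_left, norm_neg, norm_mul, norm_innerNormal, Complex.norm_real,
      Real.norm_of_nonneg ht.le, mul_one]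

/-- **Line points of a flat chart are frontier points.** [folklore] -/
theorem mem_frontier_of_line {S : Set ℂ} {k : Fin 6} {z : ℂ} {R : ℝ}
    (h : S ∩ ball z R = halfPlane k z ∩ ball z R) {w : ℂ} (hwR : w ∈ ball z R)
    (hw : ((w - z) * conj (innerNormal k)).re = 0) : w ∈ frontier S := by
  have := frontier_of_flat_chart h
  have hmem : w ∈ {w : ℂ | ((w - z) * conj (innerNormal k)).re = 0} ∩ ball z R := ⟨hw, hwR⟩
  rw [← this] at hmem
  exact hmem.1

/-- **Ray points of a convex corner chart are frontier points**: level `0` against `n_k`, level `> 0`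
against `n_k'`, inside the ball. [folklore] -/
theorem mem_frontier_of_ray_inter {S : Set ℂ} {k k' : Fin 6} {c : ℂ} {R : ℝ}
    (h : S ∩ ball c R = halfPlane k c ∩ halfPlane k' c ∩ ball c R) {w : ℂ} (hwR : w ∈ ball c R)
    (hk : ((w - c) * conj (innerNormal k)).re = 0) (hk' : 0 < ((w - c) * conj (innerNormal k')).re) :
    w ∈ frontier S := by
  refine mem_frontier_of_chart h hwR (fun hw => ?_) fun ε hε => ?_
  · have := (mem_halfPlane_iff_level k c w).1 hw.1
    rw [hk] at this; exact lt_irrefl 0 this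
  · have hgap : 0 < R - dist w c := by rw [mem_ball] at hwR; linarith
    set t : ℝ := min (ε / 2) (min (((w - c) * conj (innerNormal k')).re / 2) ((R - dist w c) / 2)) with ht
    have ht0 : 0 < t := by rw [ht]; positivity
    have ht1 : t ≤ ε / 2 := min_le_left _ _
    have ht2 : t ≤ ((w - c) * conj (innerNormal k')).re / 2 := (min_le_right _ _).trans (min_le_left _ _)
    have ht3 : t ≤ (R - dist w c) / 2 := (min_le_right _ _).trans (min_le_right _ _)
    obtain ⟨e1, e2, e3⟩ := step_estimates k k' c w ht0
    refine ⟨w + (t : ℂ) * innerNormal k, ⟨⟨?_, ?_⟩, ?_⟩, ?_⟩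
    · rw [mem_halfPlane_iff_level, e1, hk]; linarith
    · rw [mem_halfPlane_iff_level]; linarith
    · rw [mem_ball]
      calc dist (w + (t : ℂ) * innerNormal k) c ≤ dist (w + (t : ℂ) * innerNormal k) w + dist w c :=
            dist_triangle _ _ _
        _ = t + dist w c := by rw [dist_comm, e3]
        _ < R := by linarith
    · rw [e3]; linarith

/-- **Ray points of a reflex corner chart are frontier points**: level `0` against `n_k`, level `≤ 0`
against `n_k'`, inside the ball. [folklore] -/
theorem mem_frontier_of_ray_union {S : Set ℂ} {k k' : Fin 6} {c : ℂ} {R : ℝ}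
    (h : S ∩ ball c R = (halfPlane k c ∪ halfPlane k' c) ∩ ball c R) {w : ℂ} (hwR : w ∈ ball c R)
    (hk : ((w - c) * conj (innerNormal k)).re = 0) (hk' : ((w - c) * conj (innerNormal k')).re ≤ 0) :
    w ∈ frontier S := by
  refine mem_frontier_of_chart h hwR (fun hw => ?_) fun ε hε => ?_
  · rcases hw with hw | hw
    · have := (mem_halfPlane_iff_level k c w).1 hw
      rw [hk] at this; exact lt_irrefl 0 this
    · have := (mem_halfPlane_iff_level k' c w).1 hw
      linarith
  · have hgap : 0 < R - dist w c := by rw [mem_ball] at hwR; linarith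
    set t : ℝ := min (ε / 2) ((R - dist w c) / 2) with ht
    have ht0 : 0 < t := by rw [ht]; positivity
    have ht1 : t ≤ ε / 2 := min_le_left _ _
    have ht3 : t ≤ (R - dist w c) / 2 := min_le_right _ _
    obtain ⟨e1, -, e3⟩ := step_estimates k k' c w ht0
    refine ⟨w + (t : ℂ) * innerNormal k, ⟨Or.inl ?_, ?_⟩, ?_⟩
    · rw [mem_halfPlane_iff_level, e1, hk]; linarith
    · rw [mem_ball]
      calc dist (w + (t : ℂ) * innerNormal k) c ≤ dist (w + (t : ℂ) * innerNormal k) w + dist w c :=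
            dist_triangle _ _ _
        _ = t + dist w c := by rw [dist_comm, e3]
        _ < R := by linarith
    · rw [e3]; linarith

/-- **The frontier in a flat chart is the line** (registered form, sub-goal of
`stub_innerPolygonsOfZigzag`). [folklore] -/
theorem zd_frontier_of_flat_chart : ∀ (S : Set ℂ) (k : Fin 6) (z : ℂ) (R : ℝ), S ∩ Metric.ball z R = halfPlane k z ∩ Metric.ball z R → frontier S ∩ Metric.ball z R = {w : ℂ | ((w - z) * (starRingEnd ℂ) (innerNormal k)).re = 0} ∩ Metric.ball z R :=
  fun _ _ _ _ h => frontier_of_flat_chart h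

end Summit.CriticalPhenomena.SAWScalingLimit.Theorems.PolygonParitySqueeze.ZigzagDiscretisation

end
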